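import Mathlib
import HarnessLib
import Literature.MathematicalPhysics.QuantumLattice.HubbardBandSectorCountingCounts
import Summits.HubbardSuperconductivity.HubbardSuperconductivity.Theorems.KLProgrammeCountPairsOffsetGridCount
import Summits.HubbardSuperconductivity.HubbardSuperconductivity.Theorems.KLProgrammeH10TwoPointLimitPerturbedCountLipschitz

/-!
# Route `KLProgramme` — crux K1 `H10TwoPointLimit` (stmt-HubbardSuperconductivity-19938):
# the grid counts ON THE PERTURBED CURVE, I — transversal fibres, reindexing by the shift, the three shift ranges, the Cooper range

Port step (4a) of HOME/prover-p4/PORT-NOTE.md §6: the lineage's `KLProgrammeCountPairsOffsetCooper.lean` (counts for the offset level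
function `h_P` on the FREE curve) verbatim for the perturbed level function `h^E` of `KLProgrammePerturbedCountDefs.lean` (root selection
`u` of `{ε₀ + δ = μ}`, `δ ∈ C²` even, `|δ| ≤ κ₀`, `‖Dδ‖ ≤ κ₁ < Dt_min`, `‖D(Dδ)‖ ≤ κ₂` on `ℝ²`), over the tree's curve-generic grid lemmas:

* `count_transversalE(')` — the `θ₃`- (resp. `θ₂`-) fibres where `|∂₃h^E| ≥ λ` (lemma L2 with the Lipschitz constant `M_Γ` of
  `abs_h3E_three_sub_le`);
* `count_reindexE` — reindexing of the both-partials-small family by the shift `k = j - i (mod N)` (periodicity of `h^E`, `∂₃h^E`);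
* `krangeE` — the three shift ranges from `cover_perturbed`;
* `shift_transversal_perturbed` — the gated transversality of a Cooper-range shift line INCLUDING the `Dδ` term of the true derivative
  (`odd_transversal_perturbed` + `|Dδ(S)[p_E'(x) + p_E'(x+c)]| ≤ κ₁A_E|c - π|`, under `κ₁A_E ≤ h_min/2`), `count_odd_shift_perturbed`
  (lemma L3G) and `count_odd_total_perturbed` (the harmonic sum over the shifts).

Constants expanded as in `…PerturbedCountCooper/Fold/Lipschitz.lean`. Everything is PROVED; no definitions.
References: BGM 2006 Lemma 3.1 / (2.76) / (2.80) / App. A2 [cite: BenfattoGiulianiMastropietro2006]; HOME/prover-p4/COUNTING-NOTE.md.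
-/

noncomputable section

namespace Summit.HubbardSuperconductivity.HubbardSuperconductivity.Theorems.PerturbedFermiCurve

set_option linter.dupNamespace false -- summit = problem name (single-conjunct summit), D-0017

open Real Set
open Literature.MathematicalPhysics.QuantumLattice Literature.MathematicalPhysics.QuantumLattice.BandSectorCounting
open Summit.HubbardSuperconductivity.HubbardSuperconductivity.Theorems.CountPairsOffset

section Shift

variable {a b : ℝ} (B : BandBounds a b) {δ : (Fin 2 → ℝ) → ℝ} (hδs : ContDiff ℝ 2 δ) (heven : ∀ k, δ (-k) = δ k)
  {κ₀ κ₁ κ₂ μ : ℝ} (hδ : ∀ k : Fin 2 → ℝ, |δ k| ≤ κ₀) (hlo : a ≤ μ - κ₀) (hhi : μ + κ₀ ≤ b)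
  (hκ : ∀ k : Fin 2 → ℝ, ‖fderiv ℝ δ k‖ ≤ κ₁) (hκ₁ : κ₁ < B.Dtmin) (hκ₂ : ∀ k : Fin 2 → ℝ, ‖fderiv ℝ (fderiv ℝ δ) k‖ ≤ κ₂)
  {u : ℝ → ℝ} (hu : ∀ θ, IsBandFermiRadius (μ - δ (u θ • dir θ)) θ (u θ))
include B hδs hδ hlo hhi hκ hκ₁ hκ₂ hu

/-! ## The transversal fibres (lemma L2) -/

/-- **Transversal part** (fibre over `θ₂`): `Σ_{i<N} #{c<N : |h^E| ≤ δ, |∂₃h^E| ≥ λ} ≤ N·C₃`, `C₃ = (2π/(λ/(2M_Γ)) + 1)·2(4δ/(λw) + 1)`.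
[cite: BenfattoGiulianiMastropietro2006, Lemma 3.1] -/
theorem count_transversalE {P : ℝ × ℝ} {w δ' lam : ℝ} (hw : 0 < w) (hlam : 0 < lam) (hδ' : 0 ≤ δ') {N : ℕ}
    (hN : (N : ℝ) * w = 2 * π) (hMΓ : 0 < (8 * (B.smax + κ₁ * (π * Real.sqrt 2 + 2 * B.smax) / (B.Dtmin - κ₁)) ^ 2 + 2 * (κ₂ * (B.smax + κ₁ * (π * Real.sqrt 2 + 2 * B.smax) / (B.Dtmin - κ₁)) ^ 2) + 4 * ((((4 + κ₂) * (B.smax + κ₁ * (π * Real.sqrt 2 + 2 * B.smax) / (B.Dtmin - κ₁)) ^ 2 + (8 + 2 * κ₁) * ((4 + κ₁) * (π * Real.sqrt 2) / (B.Dtmin - κ₁)) + (4 + κ₁) * (π * Real.sqrt 2)) / (B.Dtmin - κ₁)) + 2 * ((4 + κ₁) * (π * Real.sqrt 2) / (B.Dtmin - κ₁)) + π * Real.sqrt 2) + κ₁ * ((((4 + κ₂) * (B.smax + κ₁ * (π * Real.sqrt 2 + 2 * B.smax) / (B.Dtmin - κ₁)) ^ 2 + (8 + 2 * κ₁) * ((4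 + κ₁) * (π * Real.sqrt 2) / (B.Dtmin - κ₁)) + (4 + κ₁) * (π * Real.sqrt 2)) / (B.Dtmin - κ₁)) + 2 * ((4 + κ₁) * (π * Real.sqrt 2) / (B.Dtmin - κ₁)) + π * Real.sqrt 2))) :
    ∑ i ∈ Finset.range N, ((((Finset.range N).filter fun c : ℕ =>
        |hfunE δ u μ P (w / 2 + i * w) (w / 2 + c * w)| ≤ δ' ∧ lam ≤ |h3E δ u P (w / 2 + i * w) (w / 2 + c * w)|).card : ℝ)) ≤
      N * ((2 * π / (lam / (2 * (8 * (B.smax + κ₁ * (π * Real.sqrt 2 + 2 * B.smax) / (B.Dtmin - κ₁)) ^ 2 + 2 * (κ₂ * (B.smax + κ₁ * (π * Real.sqrt 2 + 2 * B.smax) / (B.Dtmin - κ₁)) ^ 2) + 4 * ((((4 + κ₂) * (B.smax + κ₁ * (π * Real.sqrt 2 + 2 * B.smax) / (B.Dtmin - κ₁)) ^ 2 + (8 + 2 * κ₁) * ((4 + κ₁) * (π * Real.sqrt 2) / (B.Dtmin - κ₁)) + (4 + κ₁) * (π * Real.sqrt 2)) / (B.Dtmin - κ₁)) + 2 * ((4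 + κ₁) * (π * Real.sqrt 2) / (B.Dtmin - κ₁)) + π * Real.sqrt 2) + κ₁ * ((((4 + κ₂) * (B.smax + κ₁ * (π * Real.sqrt 2 + 2 * B.smax) / (B.Dtmin - κ₁)) ^ 2 + (8 + 2 * κ₁) * ((4 + κ₁) * (π * Real.sqrt 2) / (B.Dtmin - κ₁)) + (4 + κ₁) * (π * Real.sqrt 2)) / (B.Dtmin - κ₁)) + 2 * ((4 + κ₁) * (π * Real.sqrt 2) / (B.Dtmin - κ₁)) + π * Real.sqrt 2)))) + 1) * (2 * ((4 * δ' / lam) / w + 1))) := by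
  have h2ne : (2 : WithTop ℕ∞) ≠ 0 := by norm_num
  have hterm : ∀ i ∈ Finset.range N, ((((Finset.range N).filter fun c : ℕ =>
        |hfunE δ u μ P (w / 2 + i * w) (w / 2 + c * w)| ≤ δ' ∧ lam ≤ |h3E δ u P (w / 2 + i * w) (w / 2 + c * w)|).card : ℝ)) ≤
      (2 * π / (lam / (2 * (8 * (B.smax + κ₁ * (π * Real.sqrt 2 + 2 * B.smax) / (B.Dtmin - κ₁)) ^ 2 + 2 * (κ₂ * (B.smax + κ₁ * (π * Real.sqrt 2 + 2 * B.smax) / (B.Dtmin - κ₁)) ^ 2) + 4 * ((((4 + κ₂) * (B.smax + κ₁ * (π * Real.sqrt 2 + 2 * B.smax) / (B.Dtmin - κ₁)) ^ 2 + (8 + 2 * κ₁) * ((4 + κ₁) * (π * Real.sqrt 2) / (B.Dtmin - κ₁)) + (4 + κ₁) * (π * Real.sqrt 2)) / (B.Dtmin - κ₁)) + 2 * ((4 + κ₁) * (π * Real.sqrt 2) / (B.Dtmin - κ₁)) + π * Real.sqrt 2) + κ₁ * ((((4 + κ₂) * (B.smax + κ₁ * (π * Real.sqrt 2 + 2 *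 B.smax) / (B.Dtmin - κ₁)) ^ 2 + (8 + 2 * κ₁) * ((4 + κ₁) * (π * Real.sqrt 2) / (B.Dtmin - κ₁)) + (4 + κ₁) * (π * Real.sqrt 2)) / (B.Dtmin - κ₁)) + 2 * ((4 + κ₁) * (π * Real.sqrt 2) / (B.Dtmin - κ₁)) + π * Real.sqrt 2)))) + 1) * (2 * ((4 * δ' / lam) / w + 1)) := by
    intro i _
    have := gridCount_L2 (g := fun x => hfunE δ u μ P (w / 2 + i * w) x) (g' := fun x => h3E δ u P (w / 2 + i * w) x)
      (fun z => hasDerivAt_hfunE_three' B hδs h2ne (fun k _ => hδ k) hlo hhi (fun k _ => hκ k) hκ₁ hu P _ z) hMΓ hlam hδ'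
      (abs_h3E_three_sub_le B hδs hδ hlo hhi hκ hκ₁ hκ₂ hu P _) (x₀ := w / 2) hw N
    rw [hN] at this
    exact this
  calc _ ≤ ∑ i ∈ Finset.range N, (2 * π / (lam / (2 * (8 * (B.smax + κ₁ * (π * Real.sqrt 2 + 2 * B.smax) / (B.Dtmin - κ₁)) ^ 2 + 2 * (κ₂ * (B.smax + κ₁ * (π * Real.sqrt 2 + 2 * B.smax) / (B.Dtmin - κ₁)) ^ 2) + 4 * ((((4 + κ₂) * (B.smax + κ₁ * (π * Real.sqrt 2 + 2 * B.smax) / (B.Dtmin - κ₁)) ^ 2 + (8 + 2 * κ₁) * ((4 + κ₁) * (π * Real.sqrt 2) / (B.Dtmin - κ₁)) + (4 + κ₁) * (π * Real.sqrt 2)) / (B.Dtmin - κ₁)) + 2 * ((4 + κ₁) * (π * Real.sqrt 2) / (B.Dtmin - κ₁)) + π * Real.sqrt 2) + κ₁ * ((((4 + κ₂) * (B.smax + κ₁ * (π * Real.sqrt 2 + 2 * B.smax) / (B.Dtmin - κ₁)) ^ 2 + (8 + 2 * κ₁) * ((4 + κ₁) * (π * Real.sqrt 2) / (B.Dtmin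 - κ₁)) + (4 + κ₁) * (π * Real.sqrt 2)) / (B.Dtmin - κ₁)) + 2 * ((4 + κ₁) * (π * Real.sqrt 2) / (B.Dtmin - κ₁)) + π * Real.sqrt 2)))) + 1) * (2 * ((4 * δ' / lam) / w + 1)) := Finset.sum_le_sum hterm
    _ = _ := by rw [Finset.sum_const, Finset.card_range, nsmul_eq_mul]

/-- **Transversal part, other leg** (fibre over `θ₃`). [cite: BenfattoGiulianiMastropietro2006, Lemma 3.1] -/
theorem count_transversalE' {P : ℝ × ℝ} {w δ' lam : ℝ} (hw : 0 < w) (hlam : 0 < lam) (hδ' : 0 ≤ δ') {N : ℕ}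
    (hN : (N : ℝ) * w = 2 * π) (hMΓ : 0 < (8 * (B.smax + κ₁ * (π * Real.sqrt 2 + 2 * B.smax) / (B.Dtmin - κ₁)) ^ 2 + 2 * (κ₂ * (B.smax + κ₁ * (π * Real.sqrt 2 + 2 * B.smax) / (B.Dtmin - κ₁)) ^ 2) + 4 * ((((4 + κ₂) * (B.smax + κ₁ * (π * Real.sqrt 2 + 2 * B.smax) / (B.Dtmin - κ₁)) ^ 2 + (8 + 2 * κ₁) * ((4 + κ₁) * (π * Real.sqrt 2) / (B.Dtmin - κ₁)) + (4 + κ₁) * (π * Real.sqrt 2)) / (B.Dtmin - κ₁)) + 2 * ((4 + κ₁) * (π * Real.sqrt 2) / (B.Dtmin - κ₁)) + π * Real.sqrt 2) + κ₁ * ((((4 + κ₂) * (B.smax + κ₁ * (π * Real.sqrt 2 + 2 * B.smax) / (B.Dtmin - κ₁)) ^ 2 + (8 + 2 * κ₁) * ((4 + κ₁) * (π * Real.sqrt 2) / (B.Dtmin - κ₁)) + (4 + κ₁) * (π * Real.sqrt 2)) / (B.Dtmin - κ₁)) + 2 * ((4 + κ₁) * (π * Real.sqrt 2) / (B.Dtmin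 - κ₁)) + π * Real.sqrt 2))) :
    ∑ c ∈ Finset.range N, ((((Finset.range N).filter fun i : ℕ =>
        |hfunE δ u μ P (w / 2 + i * w) (w / 2 + c * w)| ≤ δ' ∧ lam ≤ |h3E δ u P (w / 2 + c * w) (w / 2 + i * w)|).card : ℝ)) ≤
      N * ((2 * π / (lam / (2 * (8 * (B.smax + κ₁ * (π * Real.sqrt 2 + 2 * B.smax) / (B.Dtmin - κ₁)) ^ 2 + 2 * (κ₂ * (B.smax + κ₁ * (π * Real.sqrt 2 + 2 * B.smax) / (B.Dtmin - κ₁)) ^ 2) + 4 * ((((4 + κ₂) * (B.smax + κ₁ * (π * Real.sqrt 2 + 2 * B.smax) / (B.Dtmin - κ₁)) ^ 2 + (8 + 2 * κ₁) * ((4 + κ₁) * (π * Real.sqrt 2) / (B.Dtmin - κ₁)) + (4 + κ₁) * (π * Real.sqrt 2)) / (B.Dtmin - κ₁)) + 2 * ((4 + κ₁) * (π * Real.sqrt 2) / (B.Dtmin - κ₁)) + π * Real.sqrt 2) + κ₁ * ((((4 + κ₂) * (B.smax + κ₁ * (π * Real.sqrt 2 + 2 * B.smax) / (B.Dtmin -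 κ₁)) ^ 2 + (8 + 2 * κ₁) * ((4 + κ₁) * (π * Real.sqrt 2) / (B.Dtmin - κ₁)) + (4 + κ₁) * (π * Real.sqrt 2)) / (B.Dtmin - κ₁)) + 2 * ((4 + κ₁) * (π * Real.sqrt 2) / (B.Dtmin - κ₁)) + π * Real.sqrt 2)))) + 1) * (2 * ((4 * δ' / lam) / w + 1))) := by
  have h := count_transversalE B hδs hδ hlo hhi hκ hκ₁ hκ₂ hu (P := P) hw hlam hδ' hN hMΓ
  refine le_trans (le_of_eq ?_) h
  refine Finset.sum_congr rfl fun c _ => ?_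
  congr 2
  refine Finset.filter_congr fun i _ => ?_
  rw [hfunE_swap δ u μ P (w / 2 + i * w) (w / 2 + c * w)]

/-! ## Reindexing by the shift, and the three shift ranges -/

omit hκ₂ in
/-- **Reindexing by the shift**: with `N w = 2π`, the pairs `(i, j)` of the both-partials-small family are counted by the shift
`k = j - i (mod N)` and the first index (periodicity of `h^E`, `∂₃h^E`). [folklore] -/
theorem count_reindexE {P : ℝ × ℝ} {w δ' lam : ℝ} {N : ℕ} (hN : (N : ℝ) * w = 2 * π) :
    ((((Finset.range N ×ˢ Finset.range N).filter fun p : ℕ × ℕ =>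
        |hfunE δ u μ P (w / 2 + p.1 * w) (w / 2 + p.2 * w)| ≤ δ' ∧
        |h3E δ u P (w / 2 + p.1 * w) (w / 2 + p.2 * w)| < lam ∧
        |h3E δ u P (w / 2 + p.2 * w) (w / 2 + p.1 * w)| < lam).card : ℝ)) ≤
      ∑ k ∈ Finset.range N, ((((Finset.range N).filter fun i : ℕ =>
        |hfunE δ u μ P (w / 2 + i * w) (w / 2 + i * w + k * w)| ≤ δ' ∧
        |h3E δ u P (w / 2 + i * w) (w / 2 + i * w + k * w)| < lam ∧
        |h3E δ u P (w / 2 + i * w + k * w) (w / 2 + i * w)| < lam).card : ℝ)) := by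
  rw [← card_filter_prod_eq_sum' N (fun i k =>
        |hfunE δ u μ P (w / 2 + i * w) (w / 2 + i * w + k * w)| ≤ δ' ∧
        |h3E δ u P (w / 2 + i * w) (w / 2 + i * w + k * w)| < lam ∧
        |h3E δ u P (w / 2 + i * w + k * w) (w / 2 + i * w)| < lam)]
  norm_cast
  refine Finset.card_le_card_of_injOn (fun p : ℕ × ℕ => (p.1, if p.1 ≤ p.2 then p.2 - p.1 else p.2 + N - p.1)) ?_ ?_
  · intro p hp
    rw [Finset.mem_coe, Finset.mem_filter, Finset.mem_product, Finset.mem_range, Finset.mem_range] at hp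
    obtain ⟨⟨ha, hc⟩, hQ⟩ := hp
    rw [Finset.mem_coe, Finset.mem_filter, Finset.mem_product, Finset.mem_range, Finset.mem_range]
    dsimp only
    refine ⟨⟨ha, ?_⟩, ?_⟩
    · split_ifs <;> omega
    · split_ifs with hle
      · have : w / 2 + (p.1 : ℝ) * w + ((p.2 - p.1 : ℕ) : ℝ) * w = w / 2 + p.2 * w := by
          rw [Nat.cast_sub hle]; ring
        rw [this]; exact hQ
      · push Not at hle
        have : w / 2 + (p.1 : ℝ) * w + ((p.2 + N - p.1 : ℕ) : ℝ) * w = w / 2 + p.2 * w + (1 : ℤ) * (2 * π) := by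
          rw [Nat.cast_sub (by omega : p.1 ≤ p.2 + N)]; push_cast; rw [← hN]; ring
        rw [this, hfunE_add_int_mul_two_pi_three B hδs hδ hlo hhi hκ hκ₁ hu, h3E_add_int_mul_two_pi_three B hδs hδ hlo hhi hκ hκ₁ hu,
          h3E_add_int_mul_two_pi_two B hδs hδ hlo hhi hκ hκ₁ hu]
        exact hQ
  · intro p hp q hq hpq
    rw [Finset.mem_coe, Finset.mem_filter, Finset.mem_product, Finset.mem_range, Finset.mem_range] at hp hq
    simp only [Prod.mk.injEq] at hpq
    obtain ⟨h1', h2'⟩ := hpq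
    have : p.2 = q.2 := by
      split_ifs at h2' <;> omega
    exact Prod.ext h1' this

omit hκ₂ in
/-- **The three shift ranges**: if along `θ₃ = θ₂ + k w` (`k < N`) the perturbed level function and both perturbed partials are small
somewhere, then `k w ≤ τ`, or `|k w - π| ≤ τ`, or `k w ≥ 2π - τ` (`cover_perturbed`). [cite: BenfattoGiulianiMastropietro2006, App. A2] -/
theorem krangeE {P : ℝ × ℝ} {w δ' lam τ η₀ : ℝ} (hw : 0 < w) {N k : ℕ} (hN : (N : ℝ) * w = 2 * π) (hk : k < N)
    (hτ : τ < π) (hlo' : a ≤ μ - κ₀ - η₀) (hhi' : μ + κ₀ + η₀ ≤ b) (hδη : δ' ≤ η₀)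
    (hsmall : 2 * (B.Cg * (lam / 2 + κ₁ * (B.smax + κ₁ * (π * Real.sqrt 2 + 2 * B.smax) / (B.Dtmin - κ₁)) / 2 + 2 * (κ₁ * (π * Real.sqrt 2 + 2 * B.smax) / (B.Dtmin - κ₁)) + 2 * B.smax * (η₀ / B.Dtmin) + 2 * B.smax * (2 * κ₀ / B.Dtmin))) ≤ τ) {x : ℝ}
    (hQ : |hfunE δ u μ P x (x + k * w)| ≤ δ' ∧ |h3E δ u P x (x + k * w)| < lam ∧ |h3E δ u P (x + k * w) x| < lam) :
    (k : ℝ) * w ≤ τ ∨ |(k : ℝ) * w - π| ≤ τ ∨ 2 * π - τ ≤ (k : ℝ) * w := by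
  have h2ne : (2 : WithTop ℕ∞) ≠ 0 := by norm_num
  obtain ⟨j, hj⟩ := cover_perturbed B hδs h2ne hδ hlo hhi hκ hκ₁ hu hlo' hhi' (hQ.1.trans hδη) hQ.2.2.le hQ.2.1.le hsmall
  rw [show x + k * w - x = (k : ℝ) * w by ring] at hj
  have hk0 : 0 ≤ (k : ℝ) * w := by positivity
  have hkN : (k : ℝ) * w < 2 * π := by
    calc (k : ℝ) * w < N * w := mul_lt_mul_of_pos_right (by exact_mod_cast hk) hw
      _ = 2 * π := hN
  have hτ0 : 0 ≤ τ := (abs_nonneg _).trans hj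
  have hπ := Real.pi_pos
  have hjge : 0 ≤ j := by
    by_contra hneg
    push Not at hneg
    have : (j : ℝ) ≤ -1 := by exact_mod_cast Int.le_sub_one_of_lt hneg
    have h' := (abs_le.1 hj).2
    nlinarith
  have hjle : j ≤ 2 := by
    by_contra hneg
    push Not at hneg
    have : (3 : ℝ) ≤ j := by exact_mod_cast hneg
    have h' := (abs_le.1 hj).1
    nlinarith
  interval_cases j
  · left; simpa using (abs_le.1 hj).2
  · right; left; simpa using hj
  · right; right
    have h' := (abs_le.1 hj).1
    push_cast at h'; linarith

/-! ## The Cooper range `|k w - π| ≤ τ` -/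

include heven

/-- **Gated transversality of a Cooper-range shift line on the perturbed curve, `Dδ` term included**: for `|c - π| ≤ τ`, if
`|h^E(x, x+c)| ≤ η₀` and the leg-2 perturbed partial `|∂₂h^E(x, x+c)| ≤ λ`, then the TRUE derivative of `x ↦ h^E(x, x+c)` satisfies
`|∂₂h^E + ∂₃h^E| ≥ (h_min/2)|c - π|` (`odd_transversal_perturbed` for the frozen part, `≥ h_min|c - π|`, minus the `Dδ(S)[p_E'(x) + p_E'(x+c)]`
term, `≤ κ₁A_E|c - π| ≤ (h_min/2)|c - π|`). [cite: BenfattoGiulianiMastropietro2006, App. A2] -/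
theorem shift_transversal_perturbed {P : ℝ × ℝ} {x c τ η₀ lam : ℝ} (hlo' : a ≤ μ - κ₀ - η₀) (hhi' : μ + κ₀ + η₀ ≤ b)
    (hh : |hfunE δ u μ P x (x + c)| ≤ η₀) (hΓ : |h3E δ u P (x + c) x| ≤ lam) (hc : |c - π| ≤ τ)
    (hsmall : 4 * (κ₁ * (π * Real.sqrt 2 + 2 * B.smax) / (B.Dtmin - κ₁)) * ((B.smax + κ₁ * (π * Real.sqrt 2 + 2 * B.smax) / (B.Dtmin - κ₁)) + B.smax) + (κ₂ * (B.smax + κ₁ * (π * Real.sqrt 2 + 2 * B.smax) / (B.Dtmin - κ₁)) ^ 2 + κ₁ * ((((4 + κ₂) * (B.smax + κ₁ * (π * Real.sqrt 2 + 2 * B.smax) / (B.Dtmin - κ₁)) ^ 2 + (8 + 2 * κ₁) * ((4 + κ₁) * (π * Real.sqrt 2) / (B.Dtmin - κ₁)) + (4 + κ₁) * (π * Real.sqrt 2)) / (B.Dtmin - κ₁)) + 2 * ((4 + κ₁) * (π * Real.sqrt 2) / (B.Dtmin - κ₁)) + π * Real.sqrt 2)) / 2 + 2 * ((((4 + κ₂)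 * (B.smax + κ₁ * (π * Real.sqrt 2 + 2 * B.smax) / (B.Dtmin - κ₁)) ^ 2 + (8 + 2 * κ₁) * ((4 + κ₁) * (π * Real.sqrt 2) / (B.Dtmin - κ₁)) + (4 + κ₁) * (π * Real.sqrt 2)) / (B.Dtmin - κ₁)) + 2 * ((4 + κ₁) * (π * Real.sqrt 2) / (B.Dtmin - κ₁)) + π * Real.sqrt 2) * (η₀ / B.Dtmin + 2 * κ₀ / B.Dtmin + B.smax * (B.Cg * (lam / 2 + κ₁ * (B.smax + κ₁ * (π * Real.sqrt 2 + 2 * B.smax) / (B.Dtmin - κ₁)) / 2 + 2 * (κ₁ * (π * Real.sqrt 2 + 2 * B.smax) / (B.Dtmin - κ₁)) + 2 * B.smax * (η₀ / B.Dtmin) + 2 * B.smax * (2 * κ₀ / B.Dtmin)) + τ)) ≤ B.hmin / 2)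
    (hκA : κ₁ * ((((4 + κ₂) * (B.smax + κ₁ * (π * Real.sqrt 2 + 2 * B.smax) / (B.Dtmin - κ₁)) ^ 2 + (8 + 2 * κ₁) * ((4 + κ₁) * (π * Real.sqrt 2) / (B.Dtmin - κ₁)) + (4 + κ₁) * (π * Real.sqrt 2)) / (B.Dtmin - κ₁)) + 2 * ((4 + κ₁) * (π * Real.sqrt 2) / (B.Dtmin - κ₁)) + π * Real.sqrt 2) ≤ B.hmin / 2) :
    B.hmin / 2 * |c - π| ≤ |h3E δ u P (x + c) x + h3E δ u P x (x + c)| := by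
  have h2ne : (2 : WithTop ℕ∞) ≠ 0 := by norm_num
  have hδ' : ∀ k : Fin 2 → ℝ, (∀ i, |k i| ≤ π) → |δ k| ≤ κ₀ := fun k _ => hδ k
  have hκ' : ∀ k : Fin 2 → ℝ, (∀ i, |k i| ≤ π) → ‖fderiv ℝ δ k‖ ≤ κ₁ := fun k _ => hκ k
  have hd' : ∀ k : Fin 2 → ℝ, (∀ i, |k i| ≤ π) → DifferentiableAt ℝ δ k := fun k _ => (hδs.differentiable h2ne) k
  set S := momE u P x (x + c) with hS
  set μ' := μ - δ S with hμ'def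
  have hz := abs_le.1 (hδ S)
  have hη₀ : 0 ≤ η₀ := (abs_nonneg _).trans hh
  have hμ' : μ' ∈ Icc a b := ⟨by linarith [hz.2], by linarith [hz.1]⟩
  have hh' : |eps2 (SXE u P x (x + c)) (SYE u P x (x + c)) - μ'| ≤ η₀ := by
    have : eps2 (SXE u P x (x + c)) (SYE u P x (x + c)) - μ' = hfunE δ u μ P x (x + c) := by rw [hμ'def, hS, hfunE]; ring
    rw [this]; exact hh
  have hgap : ∀ θ, |μ' - (μ - δ (u θ • dir θ))| ≤ 2 * κ₀ := by
    intro θ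
    have h1 := abs_le.1 (hδ (u θ • dir θ))
    rw [hμ'def, abs_le]; constructor <;> linarith [hz.1, hz.2]
  have hd2 : |2 * Real.sin (SXE u P x (x + c)) * VXE u x + 2 * Real.sin (SYE u P x (x + c)) * VYE u x +
      fderiv ℝ δ S ![VXE u x, VYE u x]| ≤ lam := by
    have e : 2 * Real.sin (SXE u P x (x + c)) * VXE u x + 2 * Real.sin (SYE u P x (x + c)) * VYE u x +
        fderiv ℝ δ S ![VXE u x, VYE u x] = h3E δ u P (x + c) x := by
      rw [hS, h3E, SXE_swap u P (x + c) x, SYE_swap u P (x + c) x, momE_swap u P (x + c) x]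
    rw [e]; exact hΓ
  have hodd := odd_transversal_perturbed B hδs heven hδ hlo hhi hκ hκ₁ hκ₂ hu hμ' (by linarith [hz.2]) (by linarith [hz.1]) hh' hgap
    hd2 hc hsmall
  -- the `Dδ` term of the true derivative
  obtain ⟨-, -, qvx, qvy⟩ := curve_add_pi B hδ' hlo hhi hd' hκ' hκ₁ hu heven (x + (c - π))
  rw [show x + (c - π) + π = x + c by ring] at qvx qvy
  obtain ⟨hvx, hvy⟩ := abs_VXE_sub_VXE_le B hδs hδ hlo hhi hκ hκ₁ hκ₂ hu x (x + (c - π))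
  rw [show x - (x + (c - π)) = -(c - π) by ring, abs_neg] at hvx hvy
  set AE := ((((4 + κ₂) * (B.smax + κ₁ * (π * Real.sqrt 2 + 2 * B.smax) / (B.Dtmin - κ₁)) ^ 2 + (8 + 2 * κ₁) * ((4 + κ₁) * (π * Real.sqrt 2) / (B.Dtmin - κ₁)) + (4 + κ₁) * (π * Real.sqrt 2)) / (B.Dtmin - κ₁)) + 2 * ((4 + κ₁) * (π * Real.sqrt 2) / (B.Dtmin - κ₁)) + π * Real.sqrt 2) with hAE
  clear_value AE
  have hAc : 0 ≤ AE * |c - π| := (abs_nonneg _).trans hvx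
  have e1 : |VXE u x + VXE u (x + c)| ≤ AE * |c - π| := by rw [qvx, ← sub_eq_add_neg]; exact hvx
  have e2 : |VYE u x + VYE u (x + c)| ≤ AE * |c - π| := by rw [qvy, ← sub_eq_add_neg]; exact hvy
  have hD : |fderiv ℝ δ S ![VXE u x + VXE u (x + c), VYE u x + VYE u (x + c)]| ≤ κ₁ * (AE * |c - π|) :=
    abs_fderiv_vec2_le (hκ _) hAc e1 e2
  have hid : h3E δ u P (x + c) x + h3E δ u P x (x + c) =
      (2 * Real.sin (SXE u P x (x + c)) * (VXE u x + VXE u (x + c)) + 2 * Real.sin (SYE u P x (x + c)) * (VYE u x + VYE u (x + c))) +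
        fderiv ℝ δ S ![VXE u x + VXE u (x + c), VYE u x + VYE u (x + c)] := by
    rw [hS]; unfold h3E
    rw [SXE_swap u P (x + c) x, SYE_swap u P (x + c) x, momE_swap u P (x + c) x, ← clm_vec2_add]
    ring
  rw [hid]
  have htri := abs_sub_abs_le_abs_sub
    (2 * Real.sin (SXE u P x (x + c)) * (VXE u x + VXE u (x + c)) + 2 * Real.sin (SYE u P x (x + c)) * (VYE u x + VYE u (x + c)))
    (-(fderiv ℝ δ S ![VXE u x + VXE u (x + c), VYE u x + VYE u (x + c)]))
  rw [abs_neg, sub_neg_eq_add] at htri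
  have hcp := abs_nonneg (c - π)
  nlinarith [hodd, hD, hκA, hcp, mul_le_mul_of_nonneg_right hκA hcp]

/-- **The count along a fixed Cooper-range shift on the perturbed curve** `c = k w`, `0 < |c - π| ≤ τ`, GATED by the leg-2 perturbed
partial (lemma L3G with the TRUE shift-line derivative): `#{a < N : |h^E(θ_a, θ_a + c)| ≤ δ, |∂₂h^E| ≤ λ} ≤ C₅·2·(2δ/((h_min/2)|c - π| w) + 1)`,
`C₅ = 2π/min(η₀/(2(4+κ₁)A_E τ), λ/M_Γ) + 1`. [cite: BenfattoGiulianiMastropietro2006, App. A2] -/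
theorem count_odd_shift_perturbed {P : ℝ × ℝ} {w δ' τ η₀ lam c : ℝ} (hw : 0 < w) {N : ℕ} (hN : (N : ℝ) * w = 2 * π)
    (hδ'0 : 0 ≤ δ') (hη₀ : 0 < η₀) (hlam : 0 < lam) (hτ : 0 < τ) (hδη : δ' ≤ η₀ / 2)
    (hlo' : a ≤ μ - κ₀ - η₀) (hhi' : μ + κ₀ + η₀ ≤ b) (hc : |c - π| ≤ τ) (hcpos : 0 < |c - π|)
    (hsmall : 4 * (κ₁ * (π * Real.sqrt 2 + 2 * B.smax) / (B.Dtmin - κ₁)) * ((B.smax + κ₁ * (π * Real.sqrt 2 + 2 * B.smax) / (B.Dtmin - κ₁)) + B.smax) + (κ₂ * (B.smax + κ₁ * (π * Real.sqrt 2 + 2 * B.smax) / (B.Dtmin - κ₁)) ^ 2 + κ₁ * ((((4 + κ₂) * (B.smax + κ₁ * (π * Real.sqrt 2 + 2 * B.smax) / (B.Dtmin - κ₁)) ^ 2 + (8 + 2 * κ₁) * ((4 + κ₁) * (π * Real.sqrt 2) / (B.Dtmin - κ₁)) + (4 + κ₁) * (π * Real.sqrt 2)) / (B.Dtmin - κ₁))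 + 2 * ((4 + κ₁) * (π * Real.sqrt 2) / (B.Dtmin - κ₁)) + π * Real.sqrt 2)) / 2 + 2 * ((((4 + κ₂) * (B.smax + κ₁ * (π * Real.sqrt 2 + 2 * B.smax) / (B.Dtmin - κ₁)) ^ 2 + (8 + 2 * κ₁) * ((4 + κ₁) * (π * Real.sqrt 2) / (B.Dtmin - κ₁)) + (4 + κ₁) * (π * Real.sqrt 2)) / (B.Dtmin - κ₁)) + 2 * ((4 + κ₁) * (π * Real.sqrt 2) / (B.Dtmin - κ₁)) + π * Real.sqrt 2) * (η₀ / B.Dtmin + 2 * κ₀ / B.Dtmin + B.smax * (B.Cg * (2 * lam / 2 + κ₁ * (B.smax + κ₁ * (π * Real.sqrt 2 + 2 * B.smax) / (B.Dtmin - κ₁)) / 2 + 2 * (κ₁ * (π * Real.sqrt 2 + 2 * B.smax) / (B.Dtmin - κ₁)) + 2 * B.smax * (η₀ / B.Dtmin) + 2 * B.smax * (2 * κ₀ / B.Dtmin)) + τ)) ≤ B.hmin / 2)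
    (hκA : κ₁ * ((((4 + κ₂) * (B.smax + κ₁ * (π * Real.sqrt 2 + 2 * B.smax) / (B.Dtmin - κ₁)) ^ 2 + (8 + 2 * κ₁) * ((4 + κ₁) * (π * Real.sqrt 2) / (B.Dtmin - κ₁)) + (4 + κ₁) * (π * Real.sqrt 2)) / (B.Dtmin - κ₁)) + 2 * ((4 + κ₁) * (π * Real.sqrt 2) / (B.Dtmin - κ₁)) + π * Real.sqrt 2) ≤ B.hmin / 2) (hAE : 0 < ((((4 + κ₂) * (B.smax + κ₁ * (π * Real.sqrt 2 + 2 * B.smax) / (B.Dtmin - κ₁)) ^ 2 + (8 + 2 * κ₁) * ((4 + κ₁) * (π * Real.sqrt 2) / (B.Dtmin - κ₁)) + (4 + κ₁) * (π * Real.sqrt 2)) / (B.Dtmin - κ₁)) + 2 * ((4 + κ₁) * (π * Real.sqrt 2) / (B.Dtmin - κ₁)) + π * Real.sqrt 2)) (hMΓ : 0 < (8 * (B.smax + κ₁ * (π * Real.sqrt 2 + 2 * B.smax) / (B.Dtmin - κ₁)) ^ 2 + 2 * (κ₂ * (B.smax + κ₁ * (π * Real.sqrt 2 + 2 * B.smax)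 / (B.Dtmin - κ₁)) ^ 2) + 4 * ((((4 + κ₂) * (B.smax + κ₁ * (π * Real.sqrt 2 + 2 * B.smax) / (B.Dtmin - κ₁)) ^ 2 + (8 + 2 * κ₁) * ((4 + κ₁) * (π * Real.sqrt 2) / (B.Dtmin - κ₁)) + (4 + κ₁) * (π * Real.sqrt 2)) / (B.Dtmin - κ₁)) + 2 * ((4 + κ₁) * (π * Real.sqrt 2) / (B.Dtmin - κ₁)) + π * Real.sqrt 2) + κ₁ * ((((4 + κ₂) * (B.smax + κ₁ * (π * Real.sqrt 2 + 2 * B.smax) / (B.Dtmin - κ₁)) ^ 2 + (8 + 2 * κ₁) * ((4 + κ₁) * (π * Real.sqrt 2) / (B.Dtmin - κ₁)) + (4 + κ₁) * (π * Real.sqrt 2)) / (B.Dtmin - κ₁)) + 2 * ((4 + κ₁) * (π * Real.sqrt 2) / (B.Dtmin - κ₁)) + π * Real.sqrt 2))) :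
    ((((Finset.range N).filter fun i : ℕ => |hfunE δ u μ P (w / 2 + i * w) (w / 2 + i * w + c)| ≤ δ' ∧
        |h3E δ u P (w / 2 + i * w + c) (w / 2 + i * w)| ≤ lam).card : ℝ)) ≤
      (2 * π / min (η₀ / (2 * ((4 + κ₁) * ((((4 + κ₂) * (B.smax + κ₁ * (π * Real.sqrt 2 + 2 * B.smax) / (B.Dtmin - κ₁)) ^ 2 + (8 + 2 * κ₁) * ((4 + κ₁) * (π * Real.sqrt 2) / (B.Dtmin - κ₁)) + (4 + κ₁) * (π * Real.sqrt 2)) / (B.Dtmin - κ₁)) + 2 * ((4 + κ₁) * (π * Real.sqrt 2) / (B.Dtmin - κ₁)) + π * Real.sqrt 2) * τ))) (lam / (8 * (B.smax + κ₁ * (π * Real.sqrt 2 + 2 * B.smax) / (B.Dtmin - κ₁)) ^ 2 + 2 * (κ₂ * (B.smax + κ₁ * (π * Real.sqrt 2 + 2 * B.smax) / (B.Dtmin - κ₁)) ^ 2) + 4 * ((((4 + κ₂) * (B.smax + κ₁ * (π * Real.sqrt 2 + 2 * B.smax) / (B.Dtmin - κ₁)) ^ 2 + (8 + 2 * κ₁)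 * ((4 + κ₁) * (π * Real.sqrt 2) / (B.Dtmin - κ₁)) + (4 + κ₁) * (π * Real.sqrt 2)) / (B.Dtmin - κ₁)) + 2 * ((4 + κ₁) * (π * Real.sqrt 2) / (B.Dtmin - κ₁)) + π * Real.sqrt 2) + κ₁ * ((((4 + κ₂) * (B.smax + κ₁ * (π * Real.sqrt 2 + 2 * B.smax) / (B.Dtmin - κ₁)) ^ 2 + (8 + 2 * κ₁) * ((4 + κ₁) * (π * Real.sqrt 2) / (B.Dtmin - κ₁)) + (4 + κ₁) * (π * Real.sqrt 2)) / (B.Dtmin - κ₁)) + 2 * ((4 + κ₁) * (π * Real.sqrt 2) / (B.Dtmin - κ₁)) + π * Real.sqrt 2))) + 1) *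
        (2 * ((2 * δ' / (B.hmin / 2 * |c - π|)) / w + 1)) := by
  have hh := B.hmin_pos
  have hκ₁0 : 0 ≤ κ₁ := (norm_nonneg _).trans (hκ 0)
  have h := gridCount_L3G (g := fun x => hfunE δ u μ P x (x + c))
    (g' := fun x => h3E δ u P (x + c) x + h3E δ u P x (x + c))
    (Γ := fun x => h3E δ u P (x + c) x)
    (hasDerivAt_hfunE_shift B hδs hδ hlo hhi hκ hκ₁ hu P c) (M₁ := (4 + κ₁) * ((((4 + κ₂) * (B.smax + κ₁ * (π * Real.sqrt 2 + 2 * B.smax) / (B.Dtmin - κ₁)) ^ 2 + (8 + 2 * κ₁) * ((4 + κ₁) * (π * Real.sqrt 2) / (B.Dtmin - κ₁)) + (4 + κ₁) * (π * Real.sqrt 2)) / (B.Dtmin - κ₁)) + 2 * ((4 + κ₁) * (π * Real.sqrt 2) / (B.Dtmin - κ₁)) + π * Real.sqrt 2) * τ) (MΓ := (8 * (B.smax + κ₁ * (π * Real.sqrt 2 + 2 * B.smax) / (B.Dtmin - κ₁)) ^ 2 + 2 * (κ₂ * (B.smax + κ₁ * (π * Real.sqrt 2 + 2 * B.smax) /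 (B.Dtmin - κ₁)) ^ 2) + 4 * ((((4 + κ₂) * (B.smax + κ₁ * (π * Real.sqrt 2 + 2 * B.smax) / (B.Dtmin - κ₁)) ^ 2 + (8 + 2 * κ₁) * ((4 + κ₁) * (π * Real.sqrt 2) / (B.Dtmin - κ₁)) + (4 + κ₁) * (π * Real.sqrt 2)) / (B.Dtmin - κ₁)) + 2 * ((4 + κ₁) * (π * Real.sqrt 2) / (B.Dtmin - κ₁)) + π * Real.sqrt 2) + κ₁ * ((((4 + κ₂) * (B.smax + κ₁ * (π * Real.sqrt 2 + 2 * B.smax) / (B.Dtmin - κ₁)) ^ 2 + (8 + 2 * κ₁) * ((4 + κ₁) * (π * Real.sqrt 2) / (B.Dtmin - κ₁)) + (4 + κ₁) * (π * Real.sqrt 2)) / (B.Dtmin - κ₁)) + 2 * ((4 + κ₁) * (π * Real.sqrt 2) / (B.Dtmin - κ₁)) + π * Real.sqrt 2)))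
    (lam := B.hmin / 2 * |c - π|) (η₀ := η₀) (Λ := lam) (δ := δ') (by positivity) hMΓ (by positivity) hη₀ hlam hδ'0 hδη
    (fun z => (abs_shift_derivE_le B hδs hδ hlo hhi hκ hκ₁ hκ₂ hu heven P c z).trans
      (mul_le_mul_of_nonneg_left hc (by positivity)))
    (abs_h3E_shift_sub_le B hδs hδ hlo hhi hκ hκ₁ hκ₂ hu P c)
    (fun z hz hΓ => shift_transversal_perturbed B hδs heven hδ hlo hhi hκ hκ₁ hκ₂ hu (lam := 2 * lam) hlo' hhi' hz hΓ hc hsmall hκA)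
    (x₀ := w / 2) hw N
  rw [hN] at h
  exact h

/-- **The Cooper range in total on the perturbed curve**: `Σ_{|kw - π| ≤ τ} #{a : Q'(a, k)} ≤ N + 2C₅((2δ/((h_min/2) w))·2(1 + log N)/w + N)`
(the harmonic sum over the shifts; the exact Cooper shift `k = N_h` contributes at most `N`). [cite: BenfattoGiulianiMastropietro2006, (2.80)] -/
theorem count_odd_total_perturbed {P : ℝ × ℝ} {w δ' lam τ η₀ : ℝ} (hw : 0 < w) {N Nh : ℕ} (hN : (N : ℝ) * w = 2 * π)
    (hNh : (Nh : ℝ) * w = π) (hNN : N = 2 * Nh) (hδ'0 : 0 < δ') (hη₀ : 0 < η₀) (hlam : 0 < lam) (hτ : 0 < τ)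
    (hδη : δ' ≤ η₀ / 2) (hlo' : a ≤ μ - κ₀ - η₀) (hhi' : μ + κ₀ + η₀ ≤ b)
    (hsmall : 4 * (κ₁ * (π * Real.sqrt 2 + 2 * B.smax) / (B.Dtmin - κ₁)) * ((B.smax + κ₁ * (π * Real.sqrt 2 + 2 * B.smax) / (B.Dtmin - κ₁)) + B.smax) + (κ₂ * (B.smax + κ₁ * (π * Real.sqrt 2 + 2 * B.smax) / (B.Dtmin - κ₁)) ^ 2 + κ₁ * ((((4 + κ₂) * (B.smax + κ₁ * (π * Real.sqrt 2 + 2 * B.smax) / (B.Dtmin - κ₁)) ^ 2 + (8 + 2 * κ₁) * ((4 + κ₁) * (π * Real.sqrt 2) / (B.Dtmin - κ₁)) + (4 + κ₁) * (π * Real.sqrt 2)) / (B.Dtmin - κ₁)) + 2 * ((4 + κ₁) * (π * Real.sqrt 2) / (B.Dtmin - κ₁)) + π * Real.sqrt 2)) / 2 + 2 * ((((4 + κ₂) * (B.smax + κ₁ * (π * Real.sqrt 2 + 2 * B.smax) / (B.Dtmin - κ₁)) ^ 2 + (8 + 2 * κ₁) * ((4 + κ₁) * (π * Real.sqrt 2)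 / (B.Dtmin - κ₁)) + (4 + κ₁) * (π * Real.sqrt 2)) / (B.Dtmin - κ₁)) + 2 * ((4 + κ₁) * (π * Real.sqrt 2) / (B.Dtmin - κ₁)) + π * Real.sqrt 2) * (η₀ / B.Dtmin + 2 * κ₀ / B.Dtmin + B.smax * (B.Cg * (2 * lam / 2 + κ₁ * (B.smax + κ₁ * (π * Real.sqrt 2 + 2 * B.smax) / (B.Dtmin - κ₁)) / 2 + 2 * (κ₁ * (π * Real.sqrt 2 + 2 * B.smax) / (B.Dtmin - κ₁)) + 2 * B.smax * (η₀ / B.Dtmin) + 2 * B.smax * (2 * κ₀ / B.Dtmin)) + τ)) ≤ B.hmin / 2)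
    (hκA : κ₁ * ((((4 + κ₂) * (B.smax + κ₁ * (π * Real.sqrt 2 + 2 * B.smax) / (B.Dtmin - κ₁)) ^ 2 + (8 + 2 * κ₁) * ((4 + κ₁) * (π * Real.sqrt 2) / (B.Dtmin - κ₁)) + (4 + κ₁) * (π * Real.sqrt 2)) / (B.Dtmin - κ₁)) + 2 * ((4 + κ₁) * (π * Real.sqrt 2) / (B.Dtmin - κ₁)) + π * Real.sqrt 2) ≤ B.hmin / 2) (hAE : 0 < ((((4 + κ₂) * (B.smax + κ₁ * (π * Real.sqrt 2 + 2 * B.smax) / (B.Dtmin - κ₁)) ^ 2 + (8 + 2 * κ₁) * ((4 + κ₁) * (π * Real.sqrt 2) / (B.Dtmin - κ₁)) + (4 + κ₁) * (π * Real.sqrt 2)) / (B.Dtmin - κ₁)) + 2 * ((4 + κ₁) * (π * Real.sqrt 2) / (B.Dtmin - κ₁)) + π * Real.sqrt 2)) (hMΓ : 0 < (8 * (B.smax + κ₁ * (π * Real.sqrt 2 + 2 * B.smax) / (B.Dtmin - κ₁)) ^ 2 + 2 * (κ₂ * (B.smax + κ₁ * (π * Real.sqrt 2 + 2 * B.smax)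 / (B.Dtmin - κ₁)) ^ 2) + 4 * ((((4 + κ₂) * (B.smax + κ₁ * (π * Real.sqrt 2 + 2 * B.smax) / (B.Dtmin - κ₁)) ^ 2 + (8 + 2 * κ₁) * ((4 + κ₁) * (π * Real.sqrt 2) / (B.Dtmin - κ₁)) + (4 + κ₁) * (π * Real.sqrt 2)) / (B.Dtmin - κ₁)) + 2 * ((4 + κ₁) * (π * Real.sqrt 2) / (B.Dtmin - κ₁)) + π * Real.sqrt 2) + κ₁ * ((((4 + κ₂) * (B.smax + κ₁ * (π * Real.sqrt 2 + 2 * B.smax) / (B.Dtmin - κ₁)) ^ 2 + (8 + 2 * κ₁) * ((4 + κ₁) * (π * Real.sqrt 2) / (B.Dtmin - κ₁)) + (4 + κ₁) * (π * Real.sqrt 2)) / (B.Dtmin - κ₁)) + 2 * ((4 + κ₁) * (π * Real.sqrt 2) / (B.Dtmin - κ₁)) + π * Real.sqrt 2))) :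
    ∑ k ∈ (Finset.range N).filter (fun k : ℕ => |(k : ℝ) * w - π| ≤ τ), ((((Finset.range N).filter fun i : ℕ =>
        |hfunE δ u μ P (w / 2 + i * w) (w / 2 + i * w + k * w)| ≤ δ' ∧
        |h3E δ u P (w / 2 + i * w) (w / 2 + i * w + k * w)| < lam ∧
        |h3E δ u P (w / 2 + i * w + k * w) (w / 2 + i * w)| < lam).card : ℝ)) ≤
      N + 2 * (2 * π / min (η₀ / (2 * ((4 + κ₁) * ((((4 + κ₂) * (B.smax + κ₁ * (π * Real.sqrt 2 + 2 * B.smax) / (B.Dtmin - κ₁)) ^ 2 + (8 + 2 * κ₁) * ((4 + κ₁) * (π * Real.sqrt 2) / (B.Dtmin - κ₁)) + (4 + κ₁) * (π * Real.sqrt 2)) / (B.Dtmin - κ₁)) + 2 * ((4 + κ₁) * (π * Real.sqrt 2) / (B.Dtmin - κ₁)) + π * Real.sqrt 2) * τ))) (lam / (8 * (B.smax + κ₁ * (π * Real.sqrt 2 + 2 * B.smax) / (B.Dtmin - κ₁)) ^ 2 + 2 * (κ₂ * (B.smax + κ₁ * (π * Real.sqrt 2 + 2 * B.smax) / (B.Dtmin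 - κ₁)) ^ 2) + 4 * ((((4 + κ₂) * (B.smax + κ₁ * (π * Real.sqrt 2 + 2 * B.smax) / (B.Dtmin - κ₁)) ^ 2 + (8 + 2 * κ₁) * ((4 + κ₁) * (π * Real.sqrt 2) / (B.Dtmin - κ₁)) + (4 + κ₁) * (π * Real.sqrt 2)) / (B.Dtmin - κ₁)) + 2 * ((4 + κ₁) * (π * Real.sqrt 2) / (B.Dtmin - κ₁)) + π * Real.sqrt 2) + κ₁ * ((((4 + κ₂) * (B.smax + κ₁ * (π * Real.sqrt 2 + 2 * B.smax) / (B.Dtmin - κ₁)) ^ 2 + (8 + 2 * κ₁) * ((4 + κ₁) * (π * Real.sqrt 2) / (B.Dtmin - κ₁)) + (4 + κ₁) * (π * Real.sqrt 2)) / (B.Dtmin - κ₁)) + 2 * ((4 + κ₁) * (π * Real.sqrt 2) / (B.Dtmin - κ₁)) + π * Real.sqrt 2))) + 1) *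
        ((2 * δ' / (B.hmin / 2 * w)) * (2 * (1 + Real.log N)) / w + N) := by
  have hh := B.hmin_pos
  have hκ₁0 : 0 ≤ κ₁ := (norm_nonneg _).trans (hκ 0)
  have hNh0 : 0 < Nh := by
    rcases Nat.eq_zero_or_pos Nh with h0 | h0
    · exfalso; rw [h0] at hNh; simp at hNh; linarith [Real.pi_pos]
    · exact h0
  have hNhN : Nh < N := by omega
  set S := (Finset.range N).filter (fun k : ℕ => |(k : ℝ) * w - π| ≤ τ) with hS
  set f : ℕ → ℝ := fun k => ((((Finset.range N).filter fun i : ℕ =>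
        |hfunE δ u μ P (w / 2 + i * w) (w / 2 + i * w + k * w)| ≤ δ' ∧
        |h3E δ u P (w / 2 + i * w) (w / 2 + i * w + k * w)| < lam ∧
        |h3E δ u P (w / 2 + i * w + k * w) (w / 2 + i * w)| < lam).card : ℝ)) with hf
  have hf0 : ∀ k, 0 ≤ f k := fun k => by positivity
  have hfN : ∀ k, f k ≤ N := by
    intro k
    rw [hf]; dsimp only
    have := Finset.card_filter_le (Finset.range N) (fun i : ℕ =>
        |hfunE δ u μ P (w / 2 + i * w) (w / 2 + i * w + k * w)| ≤ δ' ∧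
        |h3E δ u P (w / 2 + i * w) (w / 2 + i * w + k * w)| < lam ∧
        |h3E δ u P (w / 2 + i * w + k * w) (w / 2 + i * w)| < lam)
    rw [Finset.card_range] at this
    exact_mod_cast this
  rw [← Finset.sum_filter_add_sum_filter_not S (fun k : ℕ => k = Nh)]
  have htriv : ∑ k ∈ S.filter (fun k : ℕ => k = Nh), f k ≤ N := by
    have hsub : S.filter (fun k : ℕ => k = Nh) ⊆ {Nh} := by
      intro k hk
      rw [Finset.mem_filter] at hk
      rw [Finset.mem_singleton]; exact hk.2
    calc ∑ k ∈ S.filter (fun k : ℕ => k = Nh), f k ≤ ∑ k ∈ ({Nh} : Finset ℕ), f k :=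
          Finset.sum_le_sum_of_subset_of_nonneg hsub fun k _ _ => hf0 k
      _ = f Nh := Finset.sum_singleton _ _
      _ ≤ N := hfN Nh
  have hgood : ∑ k ∈ S.filter (fun k : ℕ => ¬ k = Nh), f k ≤
      2 * (2 * π / min (η₀ / (2 * ((4 + κ₁) * ((((4 + κ₂) * (B.smax + κ₁ * (π * Real.sqrt 2 + 2 * B.smax) / (B.Dtmin - κ₁)) ^ 2 + (8 + 2 * κ₁) * ((4 + κ₁) * (π * Real.sqrt 2) / (B.Dtmin - κ₁)) + (4 + κ₁) * (π * Real.sqrt 2)) / (B.Dtmin - κ₁)) + 2 * ((4 + κ₁) * (π * Real.sqrt 2) / (B.Dtmin - κ₁)) + π * Real.sqrt 2) * τ))) (lam / (8 * (B.smax + κ₁ * (π * Real.sqrt 2 + 2 * B.smax) / (B.Dtmin - κ₁)) ^ 2 + 2 * (κ₂ * (B.smax + κ₁ * (π * Real.sqrt 2 + 2 * B.smax) / (B.Dtmin - κ₁)) ^ 2) + 4 * ((((4 + κ₂) * (B.smax + κ₁ * (π * Real.sqrt 2 + 2 * B.smax) / (B.Dtmin - κ₁)) ^ 2 + (8 + 2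 * κ₁) * ((4 + κ₁) * (π * Real.sqrt 2) / (B.Dtmin - κ₁)) + (4 + κ₁) * (π * Real.sqrt 2)) / (B.Dtmin - κ₁)) + 2 * ((4 + κ₁) * (π * Real.sqrt 2) / (B.Dtmin - κ₁)) + π * Real.sqrt 2) + κ₁ * ((((4 + κ₂) * (B.smax + κ₁ * (π * Real.sqrt 2 + 2 * B.smax) / (B.Dtmin - κ₁)) ^ 2 + (8 + 2 * κ₁) * ((4 + κ₁) * (π * Real.sqrt 2) / (B.Dtmin - κ₁)) + (4 + κ₁) * (π * Real.sqrt 2)) / (B.Dtmin - κ₁)) + 2 * ((4 + κ₁) * (π * Real.sqrt 2) / (B.Dtmin - κ₁)) + π * Real.sqrt 2))) + 1) *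
        ((2 * δ' / (B.hmin / 2 * w)) * (2 * (1 + Real.log N)) / w + N) := by
    set C₅ := 2 * π / min (η₀ / (2 * ((4 + κ₁) * ((((4 + κ₂) * (B.smax + κ₁ * (π * Real.sqrt 2 + 2 * B.smax) / (B.Dtmin - κ₁)) ^ 2 + (8 + 2 * κ₁) * ((4 + κ₁) * (π * Real.sqrt 2) / (B.Dtmin - κ₁)) + (4 + κ₁) * (π * Real.sqrt 2)) / (B.Dtmin - κ₁)) + 2 * ((4 + κ₁) * (π * Real.sqrt 2) / (B.Dtmin - κ₁)) + π * Real.sqrt 2) * τ))) (lam / (8 * (B.smax + κ₁ * (π * Real.sqrt 2 + 2 * B.smax) / (B.Dtmin - κ₁)) ^ 2 + 2 * (κ₂ * (B.smax + κ₁ * (π * Real.sqrt 2 + 2 * B.smax) / (B.Dtmin - κ₁)) ^ 2) + 4 * ((((4 + κ₂) * (B.smax + κ₁ * (π * Real.sqrt 2 + 2 * B.smax) / (B.Dtmin - κ₁)) ^ 2 + (8 + 2 * κ₁) * ((4 + κ₁) * (π * Real.sqrt 2) / (B.Dtmin - κ₁)) + (4 + κ₁) * (π * Real.sqrt 2)) /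 (B.Dtmin - κ₁)) + 2 * ((4 + κ₁) * (π * Real.sqrt 2) / (B.Dtmin - κ₁)) + π * Real.sqrt 2) + κ₁ * ((((4 + κ₂) * (B.smax + κ₁ * (π * Real.sqrt 2 + 2 * B.smax) / (B.Dtmin - κ₁)) ^ 2 + (8 + 2 * κ₁) * ((4 + κ₁) * (π * Real.sqrt 2) / (B.Dtmin - κ₁)) + (4 + κ₁) * (π * Real.sqrt 2)) / (B.Dtmin - κ₁)) + 2 * ((4 + κ₁) * (π * Real.sqrt 2) / (B.Dtmin - κ₁)) + π * Real.sqrt 2))) + 1 with hC₅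
    have hℓ : 0 < min (η₀ / (2 * ((4 + κ₁) * ((((4 + κ₂) * (B.smax + κ₁ * (π * Real.sqrt 2 + 2 * B.smax) / (B.Dtmin - κ₁)) ^ 2 + (8 + 2 * κ₁) * ((4 + κ₁) * (π * Real.sqrt 2) / (B.Dtmin - κ₁)) + (4 + κ₁) * (π * Real.sqrt 2)) / (B.Dtmin - κ₁)) + 2 * ((4 + κ₁) * (π * Real.sqrt 2) / (B.Dtmin - κ₁)) + π * Real.sqrt 2) * τ))) (lam / (8 * (B.smax + κ₁ * (π * Real.sqrt 2 + 2 * B.smax) / (B.Dtmin - κ₁)) ^ 2 + 2 * (κ₂ * (B.smax + κ₁ * (π * Real.sqrt 2 + 2 * B.smax) / (B.Dtmin - κ₁)) ^ 2) + 4 * ((((4 + κ₂) * (B.smax + κ₁ * (π * Real.sqrt 2 + 2 * B.smax) / (B.Dtmin - κ₁)) ^ 2 + (8 + 2 * κ₁) * ((4 + κ₁) * (π * Real.sqrt 2) / (B.Dtmin - κ₁)) + (4 + κ₁) * (π * Real.sqrt 2)) / (B.Dtmin - κ₁)) + 2 * ((4 + κ₁) * (π * Real.sqrt 2) / (B.Dtmin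 - κ₁)) + π * Real.sqrt 2) + κ₁ * ((((4 + κ₂) * (B.smax + κ₁ * (π * Real.sqrt 2 + 2 * B.smax) / (B.Dtmin - κ₁)) ^ 2 + (8 + 2 * κ₁) * ((4 + κ₁) * (π * Real.sqrt 2) / (B.Dtmin - κ₁)) + (4 + κ₁) * (π * Real.sqrt 2)) / (B.Dtmin - κ₁)) + 2 * ((4 + κ₁) * (π * Real.sqrt 2) / (B.Dtmin - κ₁)) + π * Real.sqrt 2))) :=
      lt_min (by positivity) (by positivity)
    have hC₅0 : 0 ≤ C₅ := by positivity
    have hterm : ∀ k ∈ S.filter (fun k : ℕ => ¬ k = Nh),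
        f k ≤ C₅ * (2 * ((2 * δ' / (B.hmin / 2 * w)) * (1 / |(k : ℝ) - Nh|) / w + 1)) := by
      intro k hk
      rw [Finset.mem_filter, hS, Finset.mem_filter, Finset.mem_range] at hk
      obtain ⟨⟨hkN, hkτ⟩, hkNh⟩ := hk
      have hkey : |(k : ℝ) * w - π| = |(k : ℝ) - Nh| * w := by
        rw [← hNh, show (k : ℝ) * w - Nh * w = ((k : ℝ) - Nh) * w by ring, abs_mul, abs_of_pos hw]
      have hkNh' : (k : ℝ) - Nh ≠ 0 := by
        intro h0
        have : (k : ℝ) = Nh := by linarith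
        exact hkNh (by exact_mod_cast this)
      have habs : |(k : ℝ) - Nh| ≠ 0 := abs_ne_zero.2 hkNh'
      have hcpos : 0 < |(k : ℝ) * w - π| := by rw [hkey]; positivity
      have hmono : f k ≤ ((((Finset.range N).filter fun i : ℕ =>
          |hfunE δ u μ P (w / 2 + i * w) (w / 2 + i * w + k * w)| ≤ δ' ∧
          |h3E δ u P (w / 2 + i * w + k * w) (w / 2 + i * w)| ≤ lam).card : ℝ)) := by
        rw [hf]; dsimp only
        have hsub' : ((Finset.range N).filter fun i : ℕ =>
            |hfunE δ u μ P (w / 2 + i * w) (w / 2 + i * w + k * w)| ≤ δ' ∧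
            |h3E δ u P (w / 2 + i * w) (w / 2 + i * w + k * w)| < lam ∧
            |h3E δ u P (w / 2 + i * w + k * w) (w / 2 + i * w)| < lam) ⊆
            ((Finset.range N).filter fun i : ℕ =>
              |hfunE δ u μ P (w / 2 + i * w) (w / 2 + i * w + k * w)| ≤ δ' ∧
              |h3E δ u P (w / 2 + i * w + k * w) (w / 2 + i * w)| ≤ lam) := by
          intro i hi
          rw [Finset.mem_filter] at hi ⊢
          exact ⟨hi.1, hi.2.1, hi.2.2.2.le⟩
        exact_mod_cast Finset.card_le_card hsub'
      have hL := count_odd_shift_perturbed B hδs heven hδ hlo hhi hκ hκ₁ hκ₂ hu (P := P) hw hN hδ'0.le hη₀ hlam hτ hδη hlo' hhi' hkτ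
        hcpos hsmall hκA hAE hMΓ
      refine hmono.trans (hL.trans (le_of_eq ?_))
      rw [hkey, hC₅]
      field_simp
    have hsub : S.filter (fun k : ℕ => ¬ k = Nh) ⊆ (Finset.range N).filter (fun k => k ≠ Nh) := by
      intro k hk
      rw [Finset.mem_filter, hS, Finset.mem_filter] at hk
      rw [Finset.mem_filter]
      exact ⟨hk.1.1, hk.2⟩
    calc ∑ k ∈ S.filter (fun k : ℕ => ¬ k = Nh), f k
        ≤ ∑ k ∈ S.filter (fun k : ℕ => ¬ k = Nh),
            C₅ * (2 * ((2 * δ' / (B.hmin / 2 * w)) * (1 / |(k : ℝ) - Nh|) / w + 1)) := Finset.sum_le_sum hterm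
      _ ≤ ∑ k ∈ (Finset.range N).filter (fun k => k ≠ Nh),
            C₅ * (2 * ((2 * δ' / (B.hmin / 2 * w)) * (1 / |(k : ℝ) - Nh|) / w + 1)) :=
          Finset.sum_le_sum_of_subset_of_nonneg hsub fun k _ _ => by positivity
      _ = (2 * C₅ * (2 * δ' / (B.hmin / 2 * w)) / w) * ∑ k ∈ (Finset.range N).filter (fun k => k ≠ Nh), 1 / |(k : ℝ) - Nh|
            + 2 * C₅ * (((Finset.range N).filter (fun k => k ≠ Nh)).card : ℝ) := by
          have hrw : ∀ k : ℕ, C₅ * (2 * ((2 * δ' / (B.hmin / 2 * w)) * (1 / |(k : ℝ) - Nh|) / w + 1)) =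
              (2 * C₅ * (2 * δ' / (B.hmin / 2 * w)) / w) * (1 / |(k : ℝ) - Nh|) + 2 * C₅ := by
            intro k; ring
          rw [Finset.sum_congr rfl (fun k _ => hrw k), Finset.sum_add_distrib, ← Finset.mul_sum, Finset.sum_const,
            nsmul_eq_mul]
          ring
      _ ≤ (2 * C₅ * (2 * δ' / (B.hmin / 2 * w)) / w) * (2 * (1 + Real.log N)) + 2 * C₅ * N := by
          apply add_le_add
          · exact mul_le_mul_of_nonneg_left (sum_inv_abs_sub_le hNhN) (by positivity)
          · apply mul_le_mul_of_nonneg_left _ (by positivity)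
            calc ((((Finset.range N).filter (fun k => k ≠ Nh)).card : ℝ)) ≤ ((Finset.range N).card : ℝ) := by
                  exact_mod_cast Finset.card_filter_le _ _
              _ = N := by rw [Finset.card_range]
      _ = 2 * C₅ * ((2 * δ' / (B.hmin / 2 * w)) * (2 * (1 + Real.log N)) / w + N) := by ring
  linarith

end Shift

end Summit.HubbardSuperconductivity.HubbardSuperconductivity.Theorems.PerturbedFermiCurve

end
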